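import Summits.QuantumFields.YangMills.Theorems.FluctuationComparisonRegPrIntLOrganTangentFibreMeanTools
import Summits.QuantumFields.YangMills.Theorems.BalabanUVNodesN09DomAltThresholdNull
import Literature.MathematicalPhysics.QuantumFieldTheory.Balaban1983to89.T3UnitScaleTilt
import Literature.MathematicalPhysics.QuantumFieldTheory.Balaban1983to89.T3UnitLawDensityEML
import Literature.MathematicalPhysics.QuantumFieldTheory.Balaban1983to89.T3MinimiserStabilityReduction
import Literature.MathematicalPhysics.QuantumFieldTheory.Balaban1983to89.BalabanUVClass
import HarnessLib

/-!
# LINE g25-3 «VERSION COAREA», ROW PINCH∘ `FibrePinchCan` DISCHARGED: the two localised integrands of the fibre mean are continuous, the weight is `≥ 0` and `> 0` on the `¾`-window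

Cell `ym3-torus` (YM ladder rung R3 = continuum `SU(2)` Yang–Mills on the three-torus — a RUNG, NOT d = 4, NOT infinite volume, NOT a mass gap, NOT Clay).  Width seat
`ym-ust-20520-w5` (gen 21), pen (P); `--supports stmt-QuantumFields-20520 --as helper`, count-neutral, definition-free, default heartbeats; no registry, binder or `Lines/`
edit (the registered skeleton `Lines/semiclassical_s2beta.lean` v11.4 and its five stubs are untouched, 0∕5, ★★OWNER RULING №36; nothing here is `skeleton check`ed).

WHAT THIS IS.  Ideator `ym-r3-idea-1` g25's LINE g25-3 «version_coarea» v1 (`Cruxes/FluctuationComparisonRegPrIntL/Lines/version_coarea.lean`, sha16 5a1864e0c826a8b3,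
GATE ASK №18 before idea-crit-5) cuts row VER∘ `FibreMeanVersionCan` (v2.3) of LINE g25-1 «organ_tangent» into COAREA∘ `RegularFibrePackageCan` (the CONTENT: a regular
fibre package of Bałaban's averaging map — pure geometry of `descend` and Haar measure) and PINCH∘ `FibrePinchCan` (ROUTINE: a compactness pinch over O1's frame), with the
★ junction `fibreMeanVersion_of_coarea : COAREA∘ → PINCH∘ → VER∘` kernel-closed there.  PINCH∘ says: in the regime `0 < γ ≤ 1`, `0 < b₀`, `0 < p₀` and under O1's tower
block at a height `j` (`j₀ ≤ j`, `j + 1 ≤ T`), the two integrands of the localised fibre mean — `g₁ = χ·(log ρ_{j+1} − log ρ′_{j+1})·ρ′_{j+1}` and `g₂ = χ·ρ′_{j+1}`,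
`χ = sfCut θ_{j+1}` — are CONTINUOUS on the whole fine field space, `g₂ ≥ 0` everywhere, and `g₂ > 0` on `{PlaqSmall (¾θ_{j+1})}`.  THIS FILE PROVES IT (★`fibrePinch`, the row
VERBATIM with the Lines' `def sfCut` written as its term `∏_p max 0 (min 1 (3 − 4·dist1(U(∂p))∕θ))`, so that `VersionCoarea.stub_fibrePinch` is closed by `exact` through
the `def`s — DOORFIT in the seat's HOME): `0 < θ_{j+1}` in the coupling window (✓`T3MinimiserStabilityReduction.θBal_pos`); `χ` is continuous with topological support in
the closed `¾θ_{j+1}`-shell ⊂ the OPEN fine window `{PlaqSmall θ_{j+1}}` (LEAD w3 g22's ✓`OrganTangentFibreMeanTools` §4: `continuous_sfCutTerm`,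
`plaqSmall_of_sfCutTerm_ne_zero`, `tsupport_subset_plaqSmall`; the window is open: ✓`N09DomAltThresholdNull.isOpen_setOf_plaqSmall_SU`), on which the frame makes
`ρ_{j+1}, ρ′_{j+1}` continuous and positive, so `χ·g` is globally continuous for `g` continuous on the window (✓`continuous_mul_of_tsupport_subset`); `g₂ ≥ 0` because
`χ ≥ 0` (`sfCutTerm_nonneg`) and `ρ′ > 0` wherever `χ ≠ 0`; and `g₂ > 0` on the `¾`-window because every factor `max 0 (min 1 (3 − 4·dist1∕θ))` of `χ` is `> 0` iff `dist1 < ¾θ`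
(`sfCutTerm_pos_of_plaqSmall`, TOOLS §4 v1.1).
HONEST FRAMING.  Point-set topology over the tree's own objects; PINCH∘ is the ROUTINE half of the cut — the CONTENT (COAREA∘: regularity of the averaging map on the
cut-off region, the spread-lift MASS inequality, `descend_* Haar ~ Haar`) is NOT touched; nothing of Bałaban's is asserted or proved; COAREA∘, VER∘ (as a row), LIN∘, JEN∘,
O1, the five registered ∘-stubs, crux stmt-QuantumFields-20520 `FluctuationComparisonRegPrIntL` and `YM3TorusSU2` are NOT proved; no summit ∕ sub-problem statement is
proved; rung R3 = SU(2) YM₃ on T³ — NOT d = 4, NOT infinite volume, NOT a mass gap, NOT Clay; the Yang–Mills mass gap is NOT proved by any of this.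
[cite: Balaban1985Averaging, (9)-(10) p.19 and (19) p.21; Balaban1987RG1, (0.13) p.254 and (0.18) p.255; Balaban1985Variational, (2) p.278]
-/

set_option autoImplicit false

noncomputable section

namespace Summit.QuantumFields.YangMills.Theorems.FluctuationComparisonRegPrIntLVersionCoareaPinch

open MeasureTheory Filter Topology Set
open Literature.MathematicalPhysics.QuantumFieldTheory.Balaban1983to89 T3ContinuumYM3Torus T3NestedUnitLaws
  T3UnitLawDensityEML T4Continuum BalabanUVClass T3UnitScaleTilt
open Summit.QuantumFields.YangMills.Theorems.OrganTangentFibreMeanTools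
  (continuous_sfCutTerm sfCutTerm_nonneg sfCutTerm_pos_of_plaqSmall plaqSmall_of_sfCutTerm_ne_zero tsupport_subset_plaqSmall
    continuous_mul_of_tsupport_subset)
open Summit.QuantumFields.YangMills.BalabanUVNodes.N09DomAltThresholdNull (isOpen_setOf_plaqSmall_SU)

/-! ## ★ PINCH∘ discharged -/

/-- ★ **PINCH∘ `FibrePinchCan` of LINE g25-3 «version_coarea» v1, VERBATIM with the cutoff `sfCut θ U` written as its term** (`Lines/version_coarea.lean` 5a1864e0,
`def FibrePinchCan`): in the regime `0 < γ ≤ 1`, `0 < b₀`, `0 < p₀` and under O1's tower block at a height `j` (`j₀ ≤ j`, `j + 1 ≤ T`), `g₁ = χ·(log ρ_{j+1} − log ρ′_{j+1})·ρ′_{j+1}`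
and `g₂ = χ·ρ′_{j+1}` are continuous on the fine field space, `g₂ ≥ 0`, and `g₂ > 0` on `{PlaqSmall (¾θ_{j+1})}` — a compactness pinch: `tsupport χ` ⊂ the open fine window on
which the frame makes the densities continuous and positive.  Closes `VersionCoarea.stub_fibrePinch` by `exact` through the `def`s.
[cite: Balaban1987RG1, (0.13) p.254 and (0.18) p.255; Balaban1985Averaging, (10) p.19] -/
theorem fibrePinch :
    ∀ (F : T3Family) (γ b₀ p₀ : ℝ), 0 < γ → γ ≤ 1 → 0 < b₀ → 0 < p₀ → ∀ (j₀ : ℕ) (prm : ℕ → ClassParams) (η : ℕ → ℝ), ∀ (T : ℕ), ∀ (μ μ' : ((j : ℕ) → MeasureTheory.Measure (GaugeField (F.P j) 0 ↥(Matrix.specialUnitaryGroup (Fin 2) ℂ)))) (ρ ρ' : ((j : ℕ) → GaugeField (F.P j) 0 ↥(Matrix.specialUnitaryGroup (Fin 2) ℂ) → ℝ)), (∀ j : ℕ, j ≤ T → IsProbabilityMeasure (μ j) ∧ IsProbabilityMeasure (μ' j)) → (∀ j : ℕ, j < T → μ j = Measure.map (descend F ℰp j) (μ (j + 1)) ∧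 μ' j = Measure.map (descend F ℰp j) (μ' (j + 1))) → (∀ j : ℕ, j₀ ≤ j → j ≤ T → ((∀ U, PlaqSmall (θBal F.L γ b₀ p₀ j) U → 0 < ρ j U ∧ 0 < ρ' j U) ∧ μ j = (fieldMeasure _ _ _).withDensity (fun U => ENNReal.ofReal (ρ j U)) ∧ μ' j = (fieldMeasure _ _ _).withDensity (fun U => ENNReal.ofReal (ρ' j U)) ∧ MemAtHeight F ℰp j (prm j) (ρ j) ∧ MemAtHeight F ℰp j (prm j) (ρ' j) ∧ μ j {U | ¬ PlaqSmall (θBal F.L γ b₀ p₀ j) U} ≤ ENNReal.ofReal (η j) ∧ μ' j {U | ¬ PlaqSmall (θBal F.L γ b₀ p₀ j) U} ≤ ENNReal.ofReal (η j) ∧ (ContinuousOn (ρ j) {U | PlaqSmall (θBal F.L γ b₀ p₀ j) U} ∧ ContinuousOn (ρ' j) {U | PlaqSmall (θBal F.L γ b₀ p₀ j) U}))) → ∀ (j : ℕ), j₀ ≤ j → j + 1 ≤ T → Continuous (fun U => (∏ p : Plaq (F.P (j + 1)) 0, max 0 (min 1 (3 - 4 * dist1 (GaugeField.plaqHol U p)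 / θBal F.L γ b₀ p₀ (j + 1)))) * (Real.log (ρ (j + 1) U) - Real.log (ρ' (j + 1) U)) * ρ' (j + 1) U) ∧ Continuous (fun U => (∏ p : Plaq (F.P (j + 1)) 0, max 0 (min 1 (3 - 4 * dist1 (GaugeField.plaqHol U p) / θBal F.L γ b₀ p₀ (j + 1)))) * ρ' (j + 1) U) ∧ (∀ U, 0 ≤ (∏ p : Plaq (F.P (j + 1)) 0, max 0 (min 1 (3 - 4 * dist1 (GaugeField.plaqHol U p) / θBal F.L γ b₀ p₀ (j + 1)))) * ρ' (j + 1) U) ∧ (∀ U, PlaqSmall (3 / 4 * θBal F.L γ b₀ p₀ (j + 1)) U → 0 < (∏ p : Plaq (F.P (j + 1)) 0, max 0 (min 1 (3 - 4 * dist1 (GaugeField.plaqHol U p) / θBal F.L γ b₀ p₀ (j + 1)))) * ρ' (j + 1) U) := by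
  intro F γ b₀ p₀ hγ hγ1 hb₀ hp₀ j₀ prm η T μ μ' ρ ρ' _hprob _hcons hwin j hj₀ hjT
  have hθ : 0 < θBal F.L γ b₀ p₀ (j + 1) := T3MinimiserStabilityReduction.θBal_pos F.hL.2.le hγ hγ1 hb₀ p₀ (j + 1)
  obtain ⟨hpos, -, -, -, -, -, -, hcρ, hcρ'⟩ := hwin (j + 1) (by omega) hjT
  have hO : IsOpen {U : GaugeField (F.P (j + 1)) 0 ↥(Matrix.specialUnitaryGroup (Fin 2) ℂ) | PlaqSmall (θBal F.L γ b₀ p₀ (j + 1)) U} :=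
    isOpen_setOf_plaqSmall_SU 2 (F.P (j + 1)) 0 (θBal F.L γ b₀ p₀ (j + 1))
  have hχc := continuous_sfCutTerm (P := F.P (j + 1)) (k := 0) (θBal F.L γ b₀ p₀ (j + 1))
  have hχts : tsupport (fun U : GaugeField (F.P (j + 1)) 0 ↥(Matrix.specialUnitaryGroup (Fin 2) ℂ) =>
        ∏ p : Plaq (F.P (j + 1)) 0, max 0 (min 1 (3 - 4 * dist1 (GaugeField.plaqHol U p) / θBal F.L γ b₀ p₀ (j + 1)))) ⊆
      {U | PlaqSmall (θBal F.L γ b₀ p₀ (j + 1)) U} :=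
    tsupport_subset_plaqSmall (by linarith) (plaqSmall_of_sfCutTerm_ne_zero hθ)
  have hg : ContinuousOn (fun U => (Real.log (ρ (j + 1) U) - Real.log (ρ' (j + 1) U)) * ρ' (j + 1) U)
      {U | PlaqSmall (θBal F.L γ b₀ p₀ (j + 1)) U} :=
    ((hcρ.log fun U hU => (hpos U hU).1.ne').sub (hcρ'.log fun U hU => (hpos U hU).2.ne')).mul hcρ'
  refine ⟨?_, continuous_mul_of_tsupport_subset hO hχc hχts hcρ', fun U => ?_, fun U hU => ?_⟩
  · exact (continuous_mul_of_tsupport_subset hO hχc hχts hg).congr fun U => by ring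
  · by_cases hz : (∏ p : Plaq (F.P (j + 1)) 0, max 0 (min 1 (3 - 4 * dist1 (GaugeField.plaqHol U p) / θBal F.L γ b₀ p₀ (j + 1)))) = 0
    · rw [hz, zero_mul]
    · have hw : PlaqSmall (θBal F.L γ b₀ p₀ (j + 1)) U := fun p =>
        (plaqSmall_of_sfCutTerm_ne_zero hθ U hz p).trans (by linarith)
      exact mul_nonneg (sfCutTerm_nonneg _ U) (hpos U hw).2.le
  · have hw : PlaqSmall (θBal F.L γ b₀ p₀ (j + 1)) U := fun p => (hU p).trans (by linarith)
    exact mul_pos (sfCutTerm_pos_of_plaqSmall hθ U hU) (hpos U hw).2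

end Summit.QuantumFields.YangMills.Theorems.FluctuationComparisonRegPrIntLVersionCoareaPinch

end
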